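import Literature.MathematicalPhysics.QuantumFieldTheory.Balaban1983to89.B9Thm313WholeDirInputZ
import Literature.MathematicalPhysics.QuantumFieldTheory.Balaban1983to89.B9BlockNormClassTransfer

/-!
# `Balaban1983to89.B9Thm313WholeInputC` — [B9] Theorem 3.13 (p. 426), (3.153) WITH A LEFT FACTOR AND A RIGHT FACTOR READ FROM A CLASS-LOCALISED INPUT
# NORM: the engine `GG_input_of_piecesF` with the (false at the pins) fibre-localisation transfer `hasMaj_of_dom` REPLACED by dag-n06-d's
# class-multiplicity transfer `B9BlockNormClassTransfer.hasMaj_of_dom_classes_eq` (repair «R2-loc» of the located «INPUT-LOC CLASS≠FIBRE»)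

T. Bałaban, *Propagators for lattice gauge theories in a background field*, Commun. Math. Phys. **99** (1985) 389–434 [`Balaban1985BackgroundPropagators`,
"B9"]; [4] = T. Bałaban, *Propagators and renormalization transformations for lattice gauge theories. II*, Commun. Math. Phys. **96** (1984) 223–250
[`Balaban1984PropagatorsII`].  statement-level skeleton of published theorems with citation tags; proofs where landed; nothing here is a claim about
the Yang–Mills mass gap.

THE LOCATED DEFECT (dag-n06-w3 g2 `B9Letters313IMBLocObstruction.hLIM_pins_false`, dag-n06-d g9 mechanism, bus 2026-08-28).  Print's (3.44) reads
`supp λ ⊂ Δ̃(y′)` — the input Hölder norm of the N06 certificate (n06-d's pin `bHK`, `B9CoReadingCoordsInput`) is localised on the CARRIER CLASS of the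
index bond `y′` (n06-k `RelB`: all index bonds with the same carrier block, up to `2(d+1)` of them, dag-n06-l `B9CarrierBlockMultiplicity`), while the
walk letters' block sup `BlockNorm.ofBlocks … 𝔬.blk` is localised on ONE FIBRE `blk⁻¹ y′`.  The transfer `B9Thm313WholeInput.hasMaj_of_dom` used by
`B9Thm313WholeDirInput.GG_input_of_piecesF` asks `bA.IsLoc y μ → (ofBlocks … blkV).IsLoc y μ` (class ⊆ fibre) — UNSATISFIABLE at the pins.  The true
transfer ([4] (2.52)'s block sums) splits a class-localised `μ` into its fibre pieces and costs the class multiplicity `m`.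
* ★★ `GG_input_of_piecesFC` ∕ ★★ `GG_input_of_piecesFZC` (flat ∕ Z-classed letters) — `GG_input_of_piecesF(Z)` VERBATIM except: the binders `hdom hloc` are replaced by a class relation `Rel` on the blocks with
  multiplicity `m` (`hmult`), the class-constancy of the carrier distance (`hRel`, n06-l `dist_eq_of_relB` at the pins), and the two TRUE facts
  `hvanish` (the fibre pieces of a `bA`-localised `μ` outside the class of `y′` vanish) ∕ `hle` (each fibre piece inside the class has block sup
  `≤ bA.loc y′ μ`); the one transfer is `hasMaj_of_dom_classes_eq`; the printed constant's `B₀(1 − θc)⁻¹` (the `G₁F` sup entry) becomes `m·B₀(1 − θc)⁻¹`.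
HONEST SCOPE.  Bookkeeping ([4] (2.52)–(2.54), Lemma 2.1 (2.61)); Theorem 3.3-type letters remain hypotheses; count-neutral; N06 NOT discharged; one finite
lattice at a time — nothing continuum ∕ ℝ⁴ ∕ OS ∕ mass gap ∕ Clay.  Cell `pub-ymgap` (HUMAN RULING D-0062), node N06 [B9], bundle F7 rows 20–21, seat
`pub-ymgap-dag-n06-l` (g15), 2026-08-28.  NEW file; imports n06-d's transfer BY NAME; nothing landed is modified; 0 `def`.
-/

namespace Literature.MathematicalPhysics.QuantumFieldTheory.Balaban1983to89.B9Thm313WholeInputC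

open Finset B6RandomWalk B6RandomWalkHom B9Thm34Ext B9Thm37GlueCor36 B11SectG B9SectDSup
open B9Thm37AllNorms B9Thm37AllNormsInstances B9Thm312Whole B9Thm312WholeLeaf B9Thm312WholeLeft B9Thm313Whole B9Thm313WholeLeft
open B9RWSums343Holder B9Ineq347 B9Thm312WholeClasses B9Thm312WholeHolder B9Thm312WholeHHolder B9Thm313WholeHolder B9Thm313WholeInput
open B9RWSums346SecondDiff B9RWSums344InputFam B9Thm312WholeDir B9Thm313WholeDir B9Thm313WholeDirInput
open B9Thm313WholeZ B9Thm313WholeLeftZ B9Thm313WholeHolderZ B9Thm313WholeInputZ B9Thm313WholeDirZ B9Thm313WholeDirInputZ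
open B9BlockNormClassTransfer (hasMaj_of_dom_classes_eq)

noncomputable section

section OneMember

variable {g : B9.Geometry} {B : B9.Backgrounds} {X Y Z W PX PY P : Type}
variable [Fintype X] [Fintype Y] [Fintype Z] [Fintype W] [Fintype PX] [Fintype PY] [Fintype P] [Fintype g.Site]
variable {R₀ : ℝ} {H₀ : Prop}

/-- ★★ **(3.153) WITH A LEFT FACTOR E AND A GENERIC RIGHT FACTOR F READ FROM A CLASS-LOCALISED INPUT NORM** `bA` of V-functions: E𝔊F = EG₁F −
(EG₁Dv)(RDv\*G₁F) − (EG₁Q\*)(C₁QG₁F) (`E_GG_F_eq`), composed by `hasMaj_frakG_classes`; the sup entry G₁F (`entry2_of_step`) is moved from the fibre block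
sup `ofBlocks blkV` to `bA` by the CLASS-MULTIPLICITY transfer (classes of `Rel` of size `≤ m`, carrier distance constant on classes, fibre pieces of a
`bA`-localised function vanishing outside the class and dominated inside it) — constant `m·B₀(1 − θc)⁻¹` where `GG_input_of_piecesF` had `B₀(1 − θc)⁻¹`.
[cite: Balaban1985BackgroundPropagators, Thm 3.13 p.426 + (3.153) p.426 + (3.44)–(3.45) p.398 + (3.132) p.422; Balaban1984PropagatorsII, (2.52) p.232, Lemma 2.1 (2.61) p.234] -/
theorem GG_input_of_piecesFC (hG : GeoOK g) {𝔬 : Ops g B X Y Z W} {U : B.Cfg} {P' V : Type} [Fintype V]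
    {blkV : V → g.Site} {F : (V → ℝ) →ₗ[ℝ] (X → ℝ)}
    {bA : BlockNorm (toB6 g R₀ H₀) (V → ℝ)} {bP : BlockNorm (toB6 g R₀ H₀) (W → ℝ)} {bC : BlockNorm (toB6 g R₀ H₀) (P' → ℝ)}
    {E : (X → ℝ) →ₗ[ℝ] (P' → ℝ)} {θ B₀ B₃ Br K44 KD KQ δ₀ δ₃ δK r ρ₂ ρ₄ σ c : ℝ}
    (hrow : RowSum (toB6 g R₀ H₀) σ c) (hc : 0 ≤ c) (hθ : 0 ≤ θ) (hB₀ : 0 ≤ B₀) (hB₃ : 0 ≤ B₃) (hBr : 0 ≤ Br) (hK44 : 0 ≤ K44)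
    (hKD : 0 ≤ KD) (hKQ : 0 ≤ KQ) (hσ : 0 ≤ σ) (hρ₄ : 0 ≤ ρ₄) (hρ₄₂ : ρ₄ + 2 * σ ≤ ρ₂) (hρ₂r : ρ₂ ≤ r) (hρ₂₃ : ρ₂ + σ ≤ δ₃)
    (hr : 0 ≤ r) (hr0 : r ≤ δ₀) (hrK : r + σ ≤ δK) (hq : θ * c < 1)
    (hK1 : HasMaj (cNorm R₀ H₀ 𝔬.blk hG.lenle 1) (cNorm R₀ H₀ 𝔬.blk hG.lenle 1) (𝔬.G0 U ∘ₗ (𝔬.Tpi U + 𝔬.T2 U))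
      (fun a b => θ * Real.exp (-(δK * g.dist a b))))
    (he2F : HasMajorantHom (g := toB6 g R₀ H₀) blkV 𝔬.blk (𝔬.G0 U ∘ₗ F)
      (fun (a b : g.Site) => B₀ * g.len a * Real.exp (-(δ₀ * g.dist a b))))
    (hL : Letters313 𝔬 R₀ H₀ hG B₃ δ₃ U) (hI : Identities 𝔬 U)
    (Rel : g.Site → g.Site → Prop) [DecidableRel Rel] {m : ℝ} (hm : 0 ≤ m)
    (hmult : ∀ y' : g.Site, ((Finset.univ.filter (fun y'' => Rel y'' y')).card : ℝ) ≤ m)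
    (hRel : ∀ a b b' : g.Site, Rel b' b → g.dist a b' = g.dist a b)
    (hvanish : ∀ (y' : g.Site) (μ : V → ℝ), bA.IsLoc y' μ → ∀ y'' : g.Site, ¬ Rel y'' y' →
      (BlockNorm.ofBlocks (toB6 g R₀ H₀) blkV).cut y'' μ = 0)
    (hle : ∀ (y' : g.Site) (μ : V → ℝ), bA.IsLoc y' μ → ∀ y'' : g.Site, Rel y'' y' →
      (BlockNorm.ofBlocks (toB6 g R₀ H₀) blkV).loc y'' ((BlockNorm.ofBlocks (toB6 g R₀ H₀) blkV).cut y'' μ) ≤ bA.loc y' μ)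
    (hRG : HasMaj bA bP (𝔬.R U ∘ₗ 𝔬.Dvstar U ∘ₗ 𝔬.G1 U ∘ₗ F) (fun a b => Br * Real.exp (-(δ₃ * g.dist a b))))
    (hGop : HasMaj bA bC (E ∘ₗ (𝔬.G1 U ∘ₗ F)) (fun a b => K44 * Real.exp (-(ρ₂ * g.dist a b))))
    (hGD : HasMaj bP bC (E ∘ₗ (𝔬.G1 U ∘ₗ 𝔬.Dv U)) (fun a b => KD * Real.exp (-(ρ₂ * g.dist a b))))
    (hGQ : HasMaj (cNormR R₀ H₀ 𝔬.blkZ hG.lenle 1) bC (E ∘ₗ 𝔬.G1 U ∘ₗ 𝔬.Qstar U)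
      (fun a b => KQ * Real.exp (-(ρ₂ * g.dist a b)))) :
    HasMaj bA bC (E ∘ₗ (𝔬.GG U ∘ₗ F))
      (fun a b => (K44 + bP.κ * KD * Br * c + KQ * (B₃ * (B₃ * (m * B₀ * (1 - θ * c)⁻¹) * c) * c) * c) *
        Real.exp (-(ρ₄ * g.dist a b))) := by
  -- adapted from `B9Thm313WholeDirInput.GG_input_of_piecesF`: the one transfer `hasMaj_of_dom` ↦ `hasMaj_of_dom_classes_eq` (factor `m`)
  have htri : Triangle254 (toB6 g R₀ H₀) := fun a b c => hG.tri a b c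
  have hfix1 := fix_of_inverses hI.invG0' hI.invG1
  have hq1 : 0 ≤ (1 - θ * c)⁻¹ := inv_nonneg.mpr (by linarith)
  have hA₁ : 0 ≤ B₀ * (1 - θ * c)⁻¹ := mul_nonneg hB₀ hq1
  have hρ₂0 : 0 ≤ ρ₂ := by linarith
  have hρ₂₃' : ρ₂ ≤ δ₃ := by linarith
  -- QG₁F : bA → Z^{(1)} — G₁F from the sup entry, the domination, the local letter Q
  have hm2 := entry2_of_step hG hrow hθ hB₀ hr hr0 hrK hK1 he2F hfix1 hq
  have h20 : HasMaj (BlockNorm.ofBlocks (toB6 g R₀ H₀) blkV) (BlockNorm.ofBlocks (toB6 g R₀ H₀) 𝔬.blk) (𝔬.G1 U ∘ₗ F)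
      (fun a b => B₀ * (1 - θ * c)⁻¹ * g.len a * Real.exp (-(r * g.dist a b))) :=
    hasMaj_of_hasMajorantHom (G := toB6 g R₀ H₀) blkV 𝔬.blk
      (fun a b => mul_nonneg (mul_nonneg hA₁ (hG.lenle a)) (Real.exp_nonneg _)) hm2
  have h2c : HasMaj (cNorm R₀ H₀ blkV hG.lenle 0) (cNorm R₀ H₀ 𝔬.blk hG.lenle 1) (𝔬.G1 U ∘ₗ F)
      (fun a b => B₀ * (1 - θ * c)⁻¹ * Real.exp (-(r * g.dist a b))) := by
    refine (hasMaj_cNorm_of_hasMaj hG 1 0 h20).mono fun y y' => le_of_eq ?_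
    have hy : g.len y ≠ 0 := (hG.lenpos y).ne'
    simp only [wt, pow_zero, pow_one, mul_one]
    rw [mul_assoc (B₀ * (1 - θ * c)⁻¹), mul_comm (g.len y), ← mul_assoc (B₀ * (1 - θ * c)⁻¹), mul_assoc,
      mul_inv_cancel₀ hy, mul_one]
  have h2o : HasMaj (BlockNorm.ofBlocks (toB6 g R₀ H₀) blkV) (cNorm R₀ H₀ 𝔬.blk hG.lenle 1) (𝔬.G1 U ∘ₗ F)
      (fun a b => B₀ * (1 - θ * c)⁻¹ * Real.exp (-(r * g.dist a b))) := by
    have h := hasMaj_toR_src hG h2c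
    simp only [Nat.cast_zero, neg_zero] at h
    exact hasMaj_of_in_zero h
  have hA₁m : 0 ≤ m * B₀ * (1 - θ * c)⁻¹ := mul_nonneg (mul_nonneg hm hB₀) hq1
  -- the CLASS transfer (dag-n06-d `hasMaj_of_dom_classes_eq`): out of the class-localised input norm at the cost of the multiplicity `m`
  have h2A : HasMaj bA (cNorm R₀ H₀ 𝔬.blk hG.lenle 1) (𝔬.G1 U ∘ₗ F)
      (fun a b => m * B₀ * (1 - θ * c)⁻¹ * Real.exp (-(r * g.dist a b))) := by
    refine (hasMaj_of_dom_classes_eq Rel hvanish hle (fun a b => mul_nonneg hA₁ (Real.exp_nonneg _))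
      (fun a b b' hb => by rw [hRel a b b' hb]) hmult h2o).mono fun a b => le_of_eq ?_
    ring
  have hQG : HasMaj bA (cNorm R₀ H₀ 𝔬.blkZ hG.lenle 1) (𝔬.Q U ∘ₗ (𝔬.G1 U ∘ₗ F))
      (fun a b => (cNorm R₀ H₀ 𝔬.blk hG.lenle 1 (X := X)).κ * B₃ * (m * B₀ * (1 - θ * c)⁻¹) * c *
        Real.exp (-(ρ₂ * g.dist a b))) :=
    hasMaj_comp_exp htri hG.dnn hrow hB₃ hA₁m hρ₂0 hρ₂r hρ₂₃ hL.q1 h2A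
  simp only [cNorm_κ, one_mul] at hQG
  -- C₁ : Z^{(1)} → 𝔠_Z^{(1)}
  have hC : HasMaj (cNorm R₀ H₀ 𝔬.blkZ hG.lenle 1) (cNormR R₀ H₀ 𝔬.blkZ hG.lenle 1) (𝔬.C1 U)
      (fun a b => B₃ * Real.exp (-(δ₃ * g.dist a b))) := hasMaj_len_tgt hG hL.c1_1
  have hBQ0 : 0 ≤ B₃ * (m * B₀ * (1 - θ * c)⁻¹) * c := mul_nonneg (mul_nonneg hB₃ hA₁m) hc
  -- (3.153) composed
  have hfr := hasMaj_frakG_classes htri hG.dnn hrow hK44 hKD hBr hKQ hB₃ hBQ0 hρ₄ hσ hρ₄₂ hGop hGD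
    (hRG.of_rate_le hG.dnn hBr hρ₂₃') hGQ (hC.of_rate_le hG.dnn hB₃ hρ₂₃') hQG
  have hGG := hfr.congr (T' := E ∘ₗ (𝔬.GG U ∘ₗ F)) fun μ => by rw [E_GG_F_eq hI E F]
  refine hGG.mono fun a b => le_of_eq ?_
  simp only [cNorm_κ, cNormR_κ, one_mul, toB6_dist]

omit [Fintype P] in
/-- ★★ **THE SAME OVER THE Z-CLASSED LETTERS** (`Letters313Z`: the local letter `Q` and `C₁` at the block-count-weighted classes `Z_{wZ} ∕ Z_{len·wZ}`, R1-cls) —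
`B9Thm313WholeDirInputZ.GG_input_of_piecesFZ` VERBATIM except the class-multiplicity transfer in place of `hasMaj_of_dom` (constant `m·B₀(1 − θc)⁻¹`).
[cite: Balaban1985BackgroundPropagators, Thm 3.13 p.426 + (3.153) p.426 + (3.44)–(3.45) p.398 + (3.132) p.422; Balaban1984PropagatorsII, (2.52) p.232, Lemma 2.1 (2.61) p.234] -/
theorem GG_input_of_piecesFZC (hG : GeoOK g) {𝔬 : Ops g B X Y Z W} {U : B.Cfg} {P' V : Type} [Fintype V]
    {blkV : V → g.Site} {F : (V → ℝ) →ₗ[ℝ] (X → ℝ)}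
    {bA : BlockNorm (toB6 g R₀ H₀) (V → ℝ)} {bP : BlockNorm (toB6 g R₀ H₀) (W → ℝ)} {bC : BlockNorm (toB6 g R₀ H₀) (P' → ℝ)}
    {E : (X → ℝ) →ₗ[ℝ] (P' → ℝ)} {θ B₀ B₃ Br K44 KD KQ δ₀ δ₃ δK r ρ₂ ρ₄ σ c : ℝ}
    (hrow : RowSum (toB6 g R₀ H₀) σ c) (hc : 0 ≤ c) (hθ : 0 ≤ θ) (hB₀ : 0 ≤ B₀) (hB₃ : 0 ≤ B₃) (hBr : 0 ≤ Br) (hK44 : 0 ≤ K44)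
    (hKD : 0 ≤ KD) (hKQ : 0 ≤ KQ) (hσ : 0 ≤ σ) (hρ₄ : 0 ≤ ρ₄) (hρ₄₂ : ρ₄ + 2 * σ ≤ ρ₂) (hρ₂r : ρ₂ ≤ r) (hρ₂₃ : ρ₂ + σ ≤ δ₃)
    (hr : 0 ≤ r) (hr0 : r ≤ δ₀) (hrK : r + σ ≤ δK) (hq : θ * c < 1)
    (hK1 : HasMaj (cNorm R₀ H₀ 𝔬.blk hG.lenle 1) (cNorm R₀ H₀ 𝔬.blk hG.lenle 1) (𝔬.G0 U ∘ₗ (𝔬.Tpi U + 𝔬.T2 U))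
      (fun a b => θ * Real.exp (-(δK * g.dist a b))))
    (he2F : HasMajorantHom (g := toB6 g R₀ H₀) blkV 𝔬.blk (𝔬.G0 U ∘ₗ F)
      (fun (a b : g.Site) => B₀ * g.len a * Real.exp (-(δ₀ * g.dist a b))))
    {wZ : g.Site → ℝ} {hwZ : ∀ y, 0 < wZ y} (hL : Letters313Z 𝔬 R₀ H₀ hG wZ hwZ B₃ δ₃ U) (hI : Identities 𝔬 U)
    (Rel : g.Site → g.Site → Prop) [DecidableRel Rel] {m : ℝ} (hm : 0 ≤ m)
    (hmult : ∀ y' : g.Site, ((Finset.univ.filter (fun y'' => Rel y'' y')).card : ℝ) ≤ m)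
    (hRel : ∀ a b b' : g.Site, Rel b' b → g.dist a b' = g.dist a b)
    (hvanish : ∀ (y' : g.Site) (μ : V → ℝ), bA.IsLoc y' μ → ∀ y'' : g.Site, ¬ Rel y'' y' →
      (BlockNorm.ofBlocks (toB6 g R₀ H₀) blkV).cut y'' μ = 0)
    (hle : ∀ (y' : g.Site) (μ : V → ℝ), bA.IsLoc y' μ → ∀ y'' : g.Site, Rel y'' y' →
      (BlockNorm.ofBlocks (toB6 g R₀ H₀) blkV).loc y'' ((BlockNorm.ofBlocks (toB6 g R₀ H₀) blkV).cut y'' μ) ≤ bA.loc y' μ)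
    (hRG : HasMaj bA bP (𝔬.R U ∘ₗ 𝔬.Dvstar U ∘ₗ 𝔬.G1 U ∘ₗ F) (fun a b => Br * Real.exp (-(δ₃ * g.dist a b))))
    (hGop : HasMaj bA bC (E ∘ₗ (𝔬.G1 U ∘ₗ F)) (fun a b => K44 * Real.exp (-(ρ₂ * g.dist a b))))
    (hGD : HasMaj bP bC (E ∘ₗ (𝔬.G1 U ∘ₗ 𝔬.Dv U)) (fun a b => KD * Real.exp (-(ρ₂ * g.dist a b))))
    (hGQ : HasMaj (weightNorm (BlockNorm.ofBlocks (toB6 g R₀ H₀) 𝔬.blkZ) (fun y => g.len y * wZ y) fun y => (wZlen_pos hG hwZ y).le) bC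
      (E ∘ₗ 𝔬.G1 U ∘ₗ 𝔬.Qstar U) (fun a b => KQ * Real.exp (-(ρ₂ * g.dist a b)))) :
    HasMaj bA bC (E ∘ₗ (𝔬.GG U ∘ₗ F))
      (fun a b => (K44 + bP.κ * KD * Br * c + KQ * (B₃ * (B₃ * (m * B₀ * (1 - θ * c)⁻¹) * c) * c) * c) *
        Real.exp (-(ρ₄ * g.dist a b))) := by
  -- adapted from `B9Thm313WholeDirInputZ.GG_input_of_piecesFZ`: the one transfer `hasMaj_of_dom` ↦ `hasMaj_of_dom_classes_eq` (factor `m`)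
  have htri : Triangle254 (toB6 g R₀ H₀) := fun a b c => hG.tri a b c
  have hfix1 := fix_of_inverses hI.invG0' hI.invG1
  have hq1 : 0 ≤ (1 - θ * c)⁻¹ := inv_nonneg.mpr (by linarith)
  have hA₁ : 0 ≤ B₀ * (1 - θ * c)⁻¹ := mul_nonneg hB₀ hq1
  have hρ₂0 : 0 ≤ ρ₂ := by linarith
  have hρ₂₃' : ρ₂ ≤ δ₃ := by linarith
  -- QG₁F : bA → Z^{(1)} — G₁F from the sup entry, the domination, the local letter Q
  have hm2 := entry2_of_step hG hrow hθ hB₀ hr hr0 hrK hK1 he2F hfix1 hq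
  have h20 : HasMaj (BlockNorm.ofBlocks (toB6 g R₀ H₀) blkV) (BlockNorm.ofBlocks (toB6 g R₀ H₀) 𝔬.blk) (𝔬.G1 U ∘ₗ F)
      (fun a b => B₀ * (1 - θ * c)⁻¹ * g.len a * Real.exp (-(r * g.dist a b))) :=
    hasMaj_of_hasMajorantHom (G := toB6 g R₀ H₀) blkV 𝔬.blk
      (fun a b => mul_nonneg (mul_nonneg hA₁ (hG.lenle a)) (Real.exp_nonneg _)) hm2
  have h2c : HasMaj (cNorm R₀ H₀ blkV hG.lenle 0) (cNorm R₀ H₀ 𝔬.blk hG.lenle 1) (𝔬.G1 U ∘ₗ F)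
      (fun a b => B₀ * (1 - θ * c)⁻¹ * Real.exp (-(r * g.dist a b))) := by
    refine (hasMaj_cNorm_of_hasMaj hG 1 0 h20).mono fun y y' => le_of_eq ?_
    have hy : g.len y ≠ 0 := (hG.lenpos y).ne'
    simp only [wt, pow_zero, pow_one, mul_one]
    rw [mul_assoc (B₀ * (1 - θ * c)⁻¹), mul_comm (g.len y), ← mul_assoc (B₀ * (1 - θ * c)⁻¹), mul_assoc,
      mul_inv_cancel₀ hy, mul_one]
  have h2o : HasMaj (BlockNorm.ofBlocks (toB6 g R₀ H₀) blkV) (cNorm R₀ H₀ 𝔬.blk hG.lenle 1) (𝔬.G1 U ∘ₗ F)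
      (fun a b => B₀ * (1 - θ * c)⁻¹ * Real.exp (-(r * g.dist a b))) := by
    have h := hasMaj_toR_src hG h2c
    simp only [Nat.cast_zero, neg_zero] at h
    exact hasMaj_of_in_zero h
  have hA₁m : 0 ≤ m * B₀ * (1 - θ * c)⁻¹ := mul_nonneg (mul_nonneg hm hB₀) hq1
  -- the CLASS transfer (dag-n06-d `hasMaj_of_dom_classes_eq`): out of the class-localised input norm at the cost of the multiplicity `m`
  have h2A : HasMaj bA (cNorm R₀ H₀ 𝔬.blk hG.lenle 1) (𝔬.G1 U ∘ₗ F)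
      (fun a b => m * B₀ * (1 - θ * c)⁻¹ * Real.exp (-(r * g.dist a b))) := by
    refine (hasMaj_of_dom_classes_eq Rel hvanish hle (fun a b => mul_nonneg hA₁ (Real.exp_nonneg _))
      (fun a b b' hb => by rw [hRel a b b' hb]) hmult h2o).mono fun a b => le_of_eq ?_
    ring
  have hQG : HasMaj bA (cNorm R₀ H₀ 𝔬.blkZ hG.lenle 1) (𝔬.Q U ∘ₗ (𝔬.G1 U ∘ₗ F))
      (fun a b => (cNorm R₀ H₀ 𝔬.blk hG.lenle 1 (X := X)).κ * B₃ * (m * B₀ * (1 - θ * c)⁻¹) * c *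
        Real.exp (-(ρ₂ * g.dist a b))) :=
    hasMaj_comp_exp htri hG.dnn hrow hB₃ hA₁m hρ₂0 hρ₂r hρ₂₃ hL.q1 h2A
  simp only [cNorm_κ, one_mul] at hQG
  -- C₁ : Z^{(1)} → Z_{len·wZ}
  have hC : HasMaj (cNorm R₀ H₀ 𝔬.blkZ hG.lenle 1) (weightNorm (BlockNorm.ofBlocks (toB6 g R₀ H₀) 𝔬.blkZ) (fun y => g.len y * wZ y) fun y => (wZlen_pos hG hwZ y).le)
      (𝔬.C1 U) (fun a b => B₃ * Real.exp (-(δ₃ * g.dist a b))) := hL.c1_1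
  have hBQ0 : 0 ≤ B₃ * (m * B₀ * (1 - θ * c)⁻¹) * c := mul_nonneg (mul_nonneg hB₃ hA₁m) hc
  -- (3.153) composed
  have hfr := hasMaj_frakG_classes htri hG.dnn hrow hK44 hKD hBr hKQ hB₃ hBQ0 hρ₄ hσ hρ₄₂ hGop hGD
    (hRG.of_rate_le hG.dnn hBr hρ₂₃') hGQ (hC.of_rate_le hG.dnn hB₃ hρ₂₃') hQG
  have hGG := hfr.congr (T' := E ∘ₗ (𝔬.GG U ∘ₗ F)) fun μ => by rw [E_GG_F_eq hI E F]
  refine hGG.mono fun a b => le_of_eq ?_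
  simp only [cNorm_κ, weightNorm_ofBlocks_κ, one_mul, toB6_dist]

end OneMember

end

end Literature.MathematicalPhysics.QuantumFieldTheory.Balaban1983to89.B9Thm313WholeInputC
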